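import Summits.ValiantsHypothesis.ValiantsHypothesis.Theorems.KPlusLogSqLawTropicalGradedWalkDomXGlue1

/-!
# Dominance glue (type X), part 7: the wrap columns `b ≥ w`

GRW-lite `K = 4` graded-walk family (census side of the tropical root law, all `m`):
dominance glue for the EXCURSION states `(w, u, 1)`, `2 ≤ u ≤ w − 1 < m − 1`, of the design typed in
`KPlusLogSqLawTropicalGradedWalkDefs` (Leibniz term: the diagonal term of `(w, u, 0)` with the rows of the columns
`u − 1`, `u` exchanged).  This part dispatches an arbitrary rival `(a, b, l)` of a WRAP column `b ≥ w`
(intended incidence: row `b − w`, class `0`, no bend) to its slack family of `…DomX10` – `…DomX14`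
(lower cells are first reduced to class `1`, the best class of their future level, by the generic lifts of
`…GradedWalkLift`).  Template: the type-D wrap-column glue `slackD_wrapcol` of `…DomDGlue4`.

Honest framing: this is a census-side (lower-bound) construction — a quadratic family of
distinct optimal slopes for `TropRootLawAt (n+1) 4`.  It says nothing about `TropicalB` inside
its window and nothing about VP ≠ VNP.
-/

set_option linter.dupNamespace false
set_option autoImplicit false

namespace Summit.ValiantsHypothesis.ValiantsHypothesis.Theorems.LacunarySymmetroidMatrixDescartes.TropicalCensus

namespace GradedWalk

open Summit.ValiantsHypothesis.ValiantsHypothesis.Theorems.MatrixDescartes.Negative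

variable (n : ℕ)

/-! ### slack, wrap columns `b ≥ w` -/

/-- the intended incidence of a wrap column and its potential. -/
theorem interfaceX_wc (w u : ℕ) (hu2 : 2 ≤ u) (huw : u < w) (hwn : w ≤ n) (b : Fin (n + 1)) (hwb : w ≤ (b : ℕ)) :
    ((perm n w u 1 b : Fin (n + 1)) : ℕ) = (b : ℕ) - w ∧
    (lam n w u 1 b = 0) ∧
    (thX n w u * (dd n 0 : ℤ) - vv n (perm n w u 1 b) b 0 = ((0 : ℤ) - 4 * mZ n * gG n ^ 2 * ((w : ℕ) : ℤ) ^ 2)) ∧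
    (UX n w u ((perm n w u 1 b : Fin (n + 1)) : ℕ) = gG n * thX n w u * ((((b : ℕ) - w) : ℕ) : ℤ)) := by
  have hr : ((perm n w u 1 b : Fin (n + 1)) : ℕ) = (b : ℕ) - w := sigmaX_wrap n huw (by omega) hwn b hwb
  have hrb : (((perm n w u 1 b : Fin (n + 1)) : ℕ)) < (b : ℕ) := by rw [hr]; omega
  have hcw : ((((perm n w u 1 b : Fin (n + 1)) : ℕ) : ℤ)) = ((b : ℕ) : ℤ) - ((w : ℕ) : ℤ) := by
    rw [hr]; push_cast [Nat.cast_sub hwb]; ring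
  refine ⟨hr, ?_, ?_, ?_⟩
  · rw [lam_X n huw, if_pos hwb]
  · rw [dd_cast_zero, vv_upper_zero n hrb, hcw]; ring
  · rw [hr]; unfold UX; rw [show (b : ℕ) - w - (n + 1 - w) = 0 by omega, muX_zero n hu2, add_zero]

set_option maxHeartbeats 400000 in
/-- slack of the type-X certificate: wrap column `b ≥ w`, rival rows above the diagonal (classes 0 / 1). -/
theorem slackX_wc_up (w u : ℕ) (hu2 : 2 ≤ u) (huw : u < w) (hwn : w ≤ n) (a b : Fin (n + 1)) (l : Fin 4)
    (hp : ee n a b l ≠ 0) (hne : perm n w u 1 b ≠ a ∨ lam n w u 1 b ≠ l) (hwb : w ≤ (b : ℕ)) (hab : (a : ℕ) < (b : ℕ)) :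
    1 * (thX n w u * (dd n l : ℤ) - vv n a b l) <
      UX n w u a + ((thX n w u * (dd n (lam n w u 1 b) : ℤ) - vv n (perm n w u 1 b) b (lam n w u 1 b)) - UX n w u (perm n w u 1 b)) := by
  have hw1 : w ≤ n + 1 := by omega
  have huw1 : u + 1 ≤ w := by omega
  have hbn : (b : ℕ) ≤ n := by omega
  obtain ⟨hr, hlam, hT0, hUr⟩ := interfaceX_wc n w u hu2 huw hwn b hwb
  rw [hlam] at hne ⊢
  have hl : l = 0 ∨ l = 1 := by
    rcases (show l = 0 ∨ l = 1 ∨ l = 2 ∨ l = 3 by fin_cases l <;> simp) with rfl | rfl | rfl | rfl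
    · exact Or.inl rfl
    · exact Or.inr rfl
    · exact absurd (ee_upper_ge_two n hab 2 (by decide)) hp
    · exact absurd (ee_upper_ge_two n hab 3 (by decide)) hp
  obtain ⟨E0, hE0⟩ : ∃ E0, (a : ℕ) + E0 = (b : ℕ) := ⟨(b : ℕ) - (a : ℕ), by omega⟩
  have haE : (a : ℕ) = (b : ℕ) - E0 := by omega
  -- rival weights in the two possible classes, written with `E0`
  have hc : (((((b : ℕ)) - ((b : ℕ) - E0) : ℕ)) : ℤ) = ((b : ℕ) : ℤ) - ((a : ℕ) : ℤ) := by
    push_cast [Nat.cast_sub (show (b : ℕ) - E0 ≤ (b : ℕ) by omega), Nat.cast_sub (show E0 ≤ (b : ℕ) by omega)]; omega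
  have hX0 : thX n w u * (dd n 0 : ℤ) - vv n a b 0 = ((0 : ℤ) - 4 * mZ n * gG n ^ 2 * (((((b : ℕ)) - ((b : ℕ) - E0)) : ℕ) : ℤ) ^ 2) := by
    rw [dd_cast_zero, vv_upper_zero n hab, hc]; ring
  have hX1 : thX n w u * (dd n 1 : ℤ) - vv n a b 1 = (thX n w u * d1 n - conn n (((b : ℕ)) - ((b : ℕ) - E0)) ((b : ℕ))) := by
    rw [dd_cast_one, vv_upper_one n hab, haE]
  rcases Nat.lt_trichotomy (a : ℕ) ((b : ℕ) - w) with har | har | har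
  · -- above the intended cell
    have hY : UX n w u a - UX n w u ((perm n w u 1 b : Fin (n + 1)) : ℕ) = (gG n * thX n w u * ((((b : ℕ) - E0) : ℕ) : ℤ) - gG n * thX n w u * ((((b : ℕ) - w) : ℕ) : ℤ)) := by
      rw [hUr]; unfold UX; rw [show (a : ℕ) - (n + 1 - w) = 0 by omega, muX_zero n hu2, add_zero, haE]
    rcases hl with rfl | rfl
    · exact slack_of (X_wc0_up n w u b E0 hu2 huw1 (by omega) (by omega) hbn) hX0 hT0 hY
    · exact slack_of (X_wcn_up n w u b E0 hu2 huw1 (by omega) (by omega) hbn) hX1 hT0 hY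
  · -- the intended position: only class 1 is a rival
    rcases hl with rfl | rfl
    · rcases hne with h | h
      · exact absurd (Fin.ext (by omega)) h
      · exact absurd rfl h
    · have hX : thX n w u * (dd n 1 : ℤ) - vv n a b 1 = (thX n w u * d1 n - conn n (((b : ℕ)) - ((b : ℕ) - w)) ((b : ℕ))) := by
        rw [dd_cast_one, vv_upper_one n hab, har]
      have hY : UX n w u a - UX n w u ((perm n w u 1 b : Fin (n + 1)) : ℕ) = (0 : ℤ) := by
        rw [show (a : ℕ) = ((perm n w u 1 b : Fin (n + 1)) : ℕ) by omega, sub_self]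
      exact slack_of (X_wcn_at n w u b hu2 huw1 hwb hbn) hX hT0 hY
  · -- between the intended cell and the diagonal
    have hE0w : E0 + 1 ≤ w := by omega
    rcases Nat.lt_or_ge (n + 1 - w) (a : ℕ) with hblk | hpl
    · -- block rows `a = (m − w) + jp`
      obtain ⟨jp, hjp⟩ : ∃ jp, (a : ℕ) = (n + 1 - w) + jp := ⟨(a : ℕ) - (n + 1 - w), by omega⟩
      have hjp1 : 1 ≤ jp := by omega
      have hbj : (b : ℕ) = (n + 1 - w) + jp + E0 := by omega
      have hja : (a : ℕ) - (n + 1 - w) = jp := by omega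
      have hcB : (((((n + 1 - w) + jp + E0) - ((n + 1 - w) + jp) : ℕ)) : ℤ) = ((b : ℕ) : ℤ) - ((a : ℕ) : ℤ) := by
        push_cast [Nat.cast_sub (show (n + 1 - w) + jp ≤ (n + 1 - w) + jp + E0 by omega), Nat.cast_sub hw1]; omega
      have hX0B : thX n w u * (dd n 0 : ℤ) - vv n a b 0 = ((0 : ℤ) - 4 * mZ n * gG n ^ 2 * (((((n + 1 - w) + jp + E0) - ((n + 1 - w) + jp)) : ℕ) : ℤ) ^ 2) := by
        rw [dd_cast_zero, vv_upper_zero n hab, hcB]; ring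
      have hX1B : thX n w u * (dd n 1 : ℤ) - vv n a b 1 = (thX n w u * d1 n - conn n (((n + 1 - w) + jp + E0) - ((n + 1 - w) + jp)) ((n + 1 - w) + jp + E0)) := by
        rw [dd_cast_one, vv_upper_one n hab, hjp, hbj]
      have hYg : UX n w u a - UX n w u ((perm n w u 1 b : Fin (n + 1)) : ℕ) = ((gG n * thX n w u * ((((n + 1 - w) + jp) : ℕ) : ℤ) + muX n w u jp) - gG n * thX n w u * ((((n + 1 - w) + jp + E0 - w) : ℕ) : ℤ)) := by
        rw [hUr]; unfold UX; rw [hja, hjp, hbj]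
      clear hX0 hX1 hc
      rcases Nat.lt_or_ge (jp + 1) u with hjlt | hjge
      · -- bend regime `SX2`
        rw [muX_lt n (by omega)] at hYg
        rcases Nat.eq_zero_or_pos E0 with hE00 | hE01
        · exact absurd hbj (by omega)
        · rcases Nat.lt_or_ge (E0 + jp) u with hEu | hEu
          · rcases hl with rfl | rfl
            · exact slack_of (X_wc0_dnB_ltA n w u jp E0 (n + 1 - w) hjp1 hE01 (by omega) huw1 (by omega) (by omega)) hX0B hT0 hYg
            · exact slack_of (X_wcn_dnB_ltA n w u jp E0 (n + 1 - w) hjp1 hE01 (by omega) huw1 (by omega) (by omega)) hX1B hT0 hYg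
          · rcases hl with rfl | rfl
            · exact slack_of (X_wc0_dnB_ltB n w u jp E0 (n + 1 - w) hjp1 (by omega) (by omega) (by omega) (by omega) (by omega)) hX0B hT0 hYg
            · exact slack_of (X_wcn_dnB_ltB n w u jp E0 (n + 1 - w) hjp1 (by omega) (by omega) (by omega) (by omega) (by omega)) hX1B hT0 hYg
      · rcases Nat.lt_or_ge (u + 1) jp with hjge2 | hjle
        · -- bend regime `SXL`
          rw [muX_ge n (by omega)] at hYg
          rcases hl with rfl | rfl
          · exact slack_of (X_wc0_dnB_ge n w u jp E0 (n + 1 - w) hu2 (by omega) (by omega) (by omega) (by omega)) hX0B hT0 hYg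
          · exact slack_of (X_wcn_dnB_ge n w u jp E0 (n + 1 - w) hu2 (by omega) (by omega) (by omega) (by omega)) hX1B hT0 hYg
        · rcases Nat.lt_or_ge u jp with hjP | hjle2
          · -- `jp = u + 1`: bend `SXP`
            have hju : jp = u + 1 := by omega
            rw [muX_P' n hju] at hYg
            rcases hl with rfl | rfl
            · have hF := X_wc0_dnB_P n w jp E0 (n + 1 - w) (by omega) (by omega) (by omega) (by omega)
              rw [hju] at hF hYg hX0B; rw [Nat.add_sub_cancel] at hF
              exact slack_of hF hX0B hT0 hYg
            · have hF := X_wcn_dnB_P n w jp E0 (n + 1 - w) (by omega) (by omega) (by omega) (by omega)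
              rw [hju] at hF hYg hX1B; rw [Nat.add_sub_cancel] at hF
              exact slack_of hF hX1B hT0 hYg
          · rcases Nat.lt_or_ge jp u with hjR1 | hjR2
            · -- `jp = u − 1`: bend `SXR1`
              have hju : u = jp + 1 := by omega
              subst hju
              rw [muX_R1 n rfl] at hYg
              rcases Nat.eq_zero_or_pos E0 with hE00 | hE01
              · exact absurd hbj (by omega)
              · rcases hl with rfl | rfl
                · exact slack_of (X_wc0_dnB_R1a n w jp E0 (n + 1 - w) hjp1 hE01 (by omega) (by omega) (by omega)) hX0B hT0 hYg
                · exact slack_of (X_wcn_dnB_R1a n w jp E0 (n + 1 - w) hjp1 hE01 (by omega) (by omega) (by omega)) hX1B hT0 hYg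
            · -- `jp = u`: bend `SXR2`
              have hju : u = jp := by omega
              subst hju
              rw [muX_R2] at hYg
              rcases hl with rfl | rfl
              · exact slack_of (X_wc0_dnB_R2 n w u E0 (n + 1 - w) hu2 (by omega) (by omega) (by omega)) hX0B hT0 hYg
              · exact slack_of (X_wcn_dnB_R2 n w u E0 (n + 1 - w) hu2 (by omega) (by omega) (by omega)) hX1B hT0 hYg
    · -- pre-block rows
      have hY : UX n w u a - UX n w u ((perm n w u 1 b : Fin (n + 1)) : ℕ) = (gG n * thX n w u * ((((b : ℕ) - E0) : ℕ) : ℤ) - gG n * thX n w u * ((((b : ℕ) - w) : ℕ) : ℤ)) := by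
        rw [hUr]; unfold UX; rw [show (a : ℕ) - (n + 1 - w) = 0 by omega, muX_zero n hu2, add_zero, haE]
      have hpn : (b : ℕ) + w - (E0 + 1) ≤ n := by omega
      rcases Nat.lt_or_ge E0 u with hEu | hEu
      · rcases Nat.lt_or_ge (E0 + 1) u with hEu2 | hEu2
        · rcases hl with rfl | rfl
          · exact slack_of (X_wc0_dnP1 n w u b E0 (by omega) huw1 hwb hpn) hX0 hT0 hY
          · exact slack_of (X_wcn_dnP1 n w u b E0 (by omega) huw1 hwb hpn) hX1 hT0 hY
        · rcases hl with rfl | rfl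
          · exact slack_of (X_wc0_dnP1b n w u b E0 (by omega) (by omega) huw1 hwb hpn) hX0 hT0 hY
          · exact slack_of (X_wcn_dnP1b n w u b E0 (by omega) (by omega) huw1 hwb hpn) hX1 hT0 hY
      · rcases hl with rfl | rfl
        · exact slack_of (X_wc0_dnP2 n w u b E0 hu2 hEu hE0w hwb hpn) hX0 hT0 hY
        · exact slack_of (X_wcn_dnP2 n w u b E0 hu2 hEu hE0w hwb hpn) hX1 hT0 hY

set_option maxHeartbeats 400000 in
/-- slack of the type-X certificate: wrap column `b ≥ w`, rival rows on or below the diagonal. -/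
theorem slackX_wc_dn (w u : ℕ) (hu2 : 2 ≤ u) (huw : u < w) (hwn : w ≤ n) (a b : Fin (n + 1)) (l : Fin 4)
    (hp : ee n a b l ≠ 0) (hwb : w ≤ (b : ℕ)) (hba : (b : ℕ) ≤ (a : ℕ)) :
    1 * (thX n w u * (dd n l : ℤ) - vv n a b l) <
      UX n w u a + ((thX n w u * (dd n (lam n w u 1 b) : ℤ) - vv n (perm n w u 1 b) b (lam n w u 1 b)) - UX n w u (perm n w u 1 b)) := by
  have hw1 : w ≤ n + 1 := by omega
  have huw1 : u + 1 ≤ w := by omega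
  have hbn : (b : ℕ) ≤ n := by omega
  have han : (a : ℕ) ≤ n := by omega
  obtain ⟨hr, hlam, hT0, hUr⟩ := interfaceX_wc n w u hu2 huw hwn b hwb
  rw [hlam]
  rcases Nat.eq_or_lt_of_le hba with hab | hlow
  · -- the diagonal cell
    have hab' : (a : ℕ) = (b : ℕ) := hab.symm
    by_cases hcl : l = 0
    · subst hcl
      rcases Nat.lt_or_ge (n + 1 - w) (a : ℕ) with hblk | hpl
      · obtain ⟨jp, hjp⟩ : ∃ jp, (a : ℕ) = (n + 1 - w) + jp := ⟨(a : ℕ) - (n + 1 - w), by omega⟩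
        have hjp1 : 1 ≤ jp := by omega
        have hbj : (b : ℕ) = (n + 1 - w) + jp + 0 := by omega
        have hX : thX n w u * (dd n 0 : ℤ) - vv n a b 0 = ((0 : ℤ) - 4 * mZ n * gG n ^ 2 * (((((n + 1 - w) + jp + 0) - ((n + 1 - w) + jp)) : ℕ) : ℤ) ^ 2) := by
          rw [dd_cast_zero, vv_diag_zero n hab']; simp
        have hYg : UX n w u a - UX n w u ((perm n w u 1 b : Fin (n + 1)) : ℕ) = ((gG n * thX n w u * ((((n + 1 - w) + jp) : ℕ) : ℤ) + muX n w u jp) - gG n * thX n w u * ((((n + 1 - w) + jp + 0 - w) : ℕ) : ℤ)) := by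
          rw [hUr]; unfold UX; rw [show (a : ℕ) - (n + 1 - w) = jp by omega, hjp, hbj]
        rcases Nat.lt_or_ge (jp + 1) u with hjlt | hjge
        · rw [muX_lt n (by omega)] at hYg
          exact slack_of (X_wc0_dnB_ltA0 n w u jp 0 (n + 1 - w) hjp1 rfl (by omega) huw1 (by omega) (by omega)) hX hT0 hYg
        · rcases Nat.lt_or_ge (u + 1) jp with hjge2 | hjle
          · rw [muX_ge n (by omega)] at hYg
            exact slack_of (X_wc0_dnB_ge n w u jp 0 (n + 1 - w) hu2 (by omega) (by omega) (by omega) (by omega)) hX hT0 hYg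
          · rcases Nat.lt_or_ge u jp with hjP | hjle2
            · have hju : jp = u + 1 := by omega
              rw [muX_P' n hju] at hYg
              have hF := X_wc0_dnB_P n w jp 0 (n + 1 - w) (by omega) (by omega) (by omega) (by omega)
              rw [hju] at hF hYg hX; rw [Nat.add_sub_cancel] at hF
              exact slack_of hF hX hT0 hYg
            · rcases Nat.lt_or_ge jp u with hjR1 | hjR2
              · have hju : u = jp + 1 := by omega
                subst hju
                rw [muX_R1 n rfl] at hYg
                exact slack_of (X_wc0_dnB_R1z n w jp 0 (n + 1 - w) hjp1 (by omega) (by omega) (by omega)) hX hT0 hYg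
              · have hju : u = jp := by omega
                subst hju
                rw [muX_R2] at hYg
                exact slack_of (X_wc0_dnB_R2 n w u 0 (n + 1 - w) hu2 (by omega) (by omega) (by omega)) hX hT0 hYg
      · have hY : UX n w u a - UX n w u ((perm n w u 1 b : Fin (n + 1)) : ℕ) = (gG n * thX n w u * ((((b : ℕ) - 0) : ℕ) : ℤ) - gG n * thX n w u * ((((b : ℕ) - w) : ℕ) : ℤ)) := by
          rw [hUr]; unfold UX; rw [show (a : ℕ) - (n + 1 - w) = 0 by omega, muX_zero n hu2, add_zero, show (a : ℕ) = (b : ℕ) - 0 by omega]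
        have hX : thX n w u * (dd n 0 : ℤ) - vv n a b 0 = ((0 : ℤ) - 4 * mZ n * gG n ^ 2 * (((((b : ℕ)) - ((b : ℕ) - 0)) : ℕ) : ℤ) ^ 2) := by
          rw [dd_cast_zero, vv_diag_zero n hab']; simp
        exact slack_of (X_wc0_dnP1 n w u b 0 (by omega) huw1 hwb (by omega)) hX hT0 hY
    · have hθ : thX n w u ≤ LL n * ((n : ℤ) + 1) := thX_le_top n huw hwn
      have hX1 : thX n w u * (dd n 1 : ℤ) - vv n a b 1 = thX n w u * d1 n - v1 n (n + 1) b := by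
        rw [dd_cast_one, vv_diag n hab' 1 (by decide), vblk_one]
      have hXl : thX n w u * (dd n l : ℤ) - vv n a b l + 1 ≤ thX n w u * d1 n - v1 n (n + 1) b + 1 ∨ l = 1 := by
        rcases (show l = 0 ∨ l = 1 ∨ l = 2 ∨ l = 3 by fin_cases l <;> simp) with rfl | rfl | rfl | rfl
        · exact absurd rfl hcl
        · exact Or.inr rfl
        · left; rw [dd_cast_two, vv_diag n hab' 2 (by decide), vblk_two]
          linarith [lift_fut2_top n (θ := thX n w u) (b : ℕ) hθ]
        · left; rw [dd_cast_three, vv_diag n hab' 3 (by decide), vblk_three]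
          linarith [lift_fut3_top n (θ := thX n w u) (b : ℕ) hθ]
      have hXl : thX n w u * (dd n l : ℤ) - vv n a b l ≤ thX n w u * d1 n - v1 n (n + 1) b := by
        rcases hXl with h | rfl
        · linarith
        · exact le_of_eq hX1
      clear hX1 hθ
      rcases Nat.lt_or_ge (n + 1 - w) (a : ℕ) with hblk | hpl
      · obtain ⟨jp, hjp⟩ : ∃ jp, (a : ℕ) = (n + 1 - w) + jp := ⟨(a : ℕ) - (n + 1 - w), by omega⟩
        have hjp1 : 1 ≤ jp := by omega
        have hq : n + (jp + 1) = (b : ℕ) + w := by omega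
        have hYg : UX n w u a - UX n w u ((perm n w u 1 b : Fin (n + 1)) : ℕ) = ((gG n * thX n w u * (((n + 1 - w + jp) : ℕ) : ℤ) + muX n w u jp) - gG n * thX n w u * ((((b : ℕ) - w) : ℕ) : ℤ)) := by
          rw [hUr]; unfold UX; rw [show (a : ℕ) - (n + 1 - w) = jp by omega, hjp]
        rcases Nat.lt_or_ge (jp + 1) u with hjlt | hjge
        · rw [muX_lt n (by omega)] at hYg
          exact slack_le (X_wblk_B_lt_m n w u b jp hjp1 (by omega) huw1 hwb hq) hXl hT0 hYg
        · rcases Nat.lt_or_ge (u + 1) jp with hjge2 | hjle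
          · rw [muX_ge n (by omega)] at hYg
            exact slack_le (X_wblk_B_ge_m n w u b jp hu2 (by omega) (by omega) hwb hq) hXl hT0 hYg
          · rcases Nat.lt_or_ge u jp with hjP | hjle2
            · have hju : jp = u + 1 := by omega
              rw [muX_P' n hju] at hYg
              have hF := X_wblk_B_P_m n w b jp (by omega) (by omega) hwb hq
              rw [hju] at hF hYg; rw [Nat.add_sub_cancel] at hF
              exact slack_le hF hXl hT0 hYg
            · rcases Nat.lt_or_ge jp u with hjR1 | hjR2
              · have hju : u = jp + 1 := by omega
                subst hju
                rw [muX_R1 n rfl] at hYg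
                exact slack_le (X_wblk_B_R1_m n w b jp hjp1 (by omega) hwb hq) hXl hT0 hYg
              · have hju : u = jp := by omega
                subst hju
                rw [muX_R2] at hYg
                exact slack_le (X_wblk_B_R2_m n w b u hu2 (by omega) hwb hq) hXl hT0 hYg
      · have hY : UX n w u a - UX n w u ((perm n w u 1 b : Fin (n + 1)) : ℕ) = (gG n * thX n w u * (((b : ℕ) : ℕ) : ℤ) - gG n * thX n w u * ((((b : ℕ) - w) : ℕ) : ℤ)) := by
          rw [hUr]; unfold UX; rw [show (a : ℕ) - (n + 1 - w) = 0 by omega, muX_zero n hu2, add_zero, hab']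
        exact slack_le (X_wblk_P_m n w u b hu2 huw1 hwb (by omega)) hXl hT0 hY
  · -- below the diagonal: a lower cell at the future level `E = m + b − a ≥ w + 1`
    have hcl : l ≠ 0 := fun h0 => by subst h0; exact hp (ee_lower_zero n hlow)
    obtain ⟨E, hEa⟩ : ∃ E, n + 1 + (b : ℕ) - (a : ℕ) = E := ⟨_, rfl⟩
    have hne1 : E ≠ n + 1 := by omega
    have hwE : w + 1 ≤ E := by omega
    have hθ : thX n w u ≤ LL n * ((E : ℕ) : ℤ) := thX_le_LE n huw hwn hwE
    have hX1 : thX n w u * (dd n 1 : ℤ) - vv n a b 1 = thX n w u * d1 n - v1 n E b := by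
      rw [dd_cast_one, vv_lower n hlow, hEa, vblk_one]
    have hXl : thX n w u * (dd n l : ℤ) - vv n a b l + 1 ≤ thX n w u * d1 n - v1 n E b + 1 ∨ l = 1 := by
      rcases (show l = 0 ∨ l = 1 ∨ l = 2 ∨ l = 3 by fin_cases l <;> simp) with rfl | rfl | rfl | rfl
      · exact absurd rfl hcl
      · exact Or.inr rfl
      · left; rw [dd_cast_two, vv_lower n hlow, hEa, vblk_two, tau2_of_ne n hne1]
        linarith [lift_fut2 n (θ := thX n w u) (E := E) (b : ℕ) hθ]
      · left; rw [dd_cast_three, vv_lower n hlow, hEa, vblk_three, tau2_of_ne n hne1, tau3_of_ne n hne1]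
        linarith [lift_fut3 n (θ := thX n w u) (E := E) (b : ℕ) hθ]
    have hXl : thX n w u * (dd n l : ℤ) - vv n a b l ≤ thX n w u * d1 n - v1 n E b := by
      rcases hXl with h | rfl
      · linarith
      · exact le_of_eq hX1
    clear hX1 hθ
    rcases Nat.lt_or_ge (n + 1 - w) (a : ℕ) with hblk | hpl
    · obtain ⟨jp, hjp⟩ : ∃ jp, (a : ℕ) = (n + 1 - w) + jp := ⟨(a : ℕ) - (n + 1 - w), by omega⟩
      have hjp1 : 1 ≤ jp := by omega
      have hq : (b : ℕ) + w - jp ≤ n := by omega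
      have hYg : UX n w u a - UX n w u ((perm n w u 1 b : Fin (n + 1)) : ℕ) = ((gG n * thX n w u * (((n + 1 - w + jp) : ℕ) : ℤ) + muX n w u jp) - gG n * thX n w u * ((((b : ℕ) - w) : ℕ) : ℤ)) := by
        rw [hUr]; unfold UX; rw [show (a : ℕ) - (n + 1 - w) = jp by omega, hjp]
      rw [show E = w + (b : ℕ) - jp by omega] at hXl
      rcases Nat.lt_or_ge (jp + 1) u with hjlt | hjge
      · rw [muX_lt n (by omega)] at hYg
        exact slack_le (X_wblk_B_lt_lt n w u b jp hjp1 (by omega) huw1 hwb hq) hXl hT0 hYg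
      · rcases Nat.lt_or_ge (u + 1) jp with hjge2 | hjle
        · rw [muX_ge n (by omega)] at hYg
          exact slack_le (X_wblk_B_ge_lt n w u b jp hu2 (by omega) (by omega) hwb hq) hXl hT0 hYg
        · rcases Nat.lt_or_ge u jp with hjP | hjle2
          · have hju : jp = u + 1 := by omega
            rw [muX_P' n hju] at hYg
            have hF := X_wblk_B_P_lt n w b jp (by omega) (by omega) hwb hq
            rw [hju] at hF hYg hXl; rw [Nat.add_sub_cancel] at hF
            exact slack_le hF hXl hT0 hYg
          · rcases Nat.lt_or_ge jp u with hjR1 | hjR2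
            · have hju : u = jp + 1 := by omega
              subst hju
              rw [muX_R1 n rfl] at hYg
              exact slack_le (X_wblk_B_R1_lt n w b jp hjp1 (by omega) hwb hq) hXl hT0 hYg
            · have hju : u = jp := by omega
              subst hju
              rw [muX_R2] at hYg
              exact slack_le (X_wblk_B_R2_lt n w b u hu2 (by omega) hwb hq) hXl hT0 hYg
    · have hY : UX n w u a - UX n w u ((perm n w u 1 b : Fin (n + 1)) : ℕ) = (gG n * thX n w u * (((n + 1 - E + (b : ℕ)) : ℕ) : ℤ) - gG n * thX n w u * ((((b : ℕ) - w) : ℕ) : ℤ)) := by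
        rw [hUr]; unfold UX; rw [show (a : ℕ) - (n + 1 - w) = 0 by omega, muX_zero n hu2, add_zero, show (a : ℕ) = n + 1 - E + (b : ℕ) by omega]
      exact slack_le (X_wblk_P_lt n w u b E hu2 huw1 hwb (by omega) (by omega)) hXl hT0 hY

/-- slack of the type-X certificate: the wrap columns `b ≥ w`. -/
theorem slackX_wc (w u : ℕ) (hu2 : 2 ≤ u) (huw : u < w) (hwn : w ≤ n) (a b : Fin (n + 1)) (l : Fin 4)
    (hp : ee n a b l ≠ 0) (hne : perm n w u 1 b ≠ a ∨ lam n w u 1 b ≠ l) (hwb : w ≤ (b : ℕ)) :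
    1 * (thX n w u * (dd n l : ℤ) - vv n a b l) <
      UX n w u a + ((thX n w u * (dd n (lam n w u 1 b) : ℤ) - vv n (perm n w u 1 b) b (lam n w u 1 b)) - UX n w u (perm n w u 1 b)) := by
  rcases Nat.lt_or_ge (a : ℕ) (b : ℕ) with hab | hba
  · exact slackX_wc_up n w u hu2 huw hwn a b l hp hne hwb hab
  · exact slackX_wc_dn n w u hu2 huw hwn a b l hp hwb hba

end GradedWalk

end Summit.ValiantsHypothesis.ValiantsHypothesis.Theorems.LacunarySymmetroidMatrixDescartes.TropicalCensus
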